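import Literature.AlgebraicGeometry.ShimuraVarieties.UnitaryCurveAuxiliaryPeriodMap
import Literature.AlgebraicGeometry.ModuliOfAbelianVarieties.SiegelModuliRelation
import Mathlib.LinearAlgebra.Charpoly.ToMatrix
import HarnessLib

/-!
# The `M`-action on `(V_M ⊗ ℝ, J_Φ(v))`: it is `J_Φ`-linear, adjoint to its conjugate for `ψ_V`, and its LIE TYPE (eigenvalue census on the
# `+i`-eigenrows ∕ on `Lie = (ℂ^g, Φ_Z)`) — Kottwitz's determinant datum and the Rosati relation at the frame level (any rank `n`, frame-free)

Topic `AlgebraicGeometry/ShimuraVarieties`; namespace `Literature.AlgebraicGeometry.ShimuraVarieties.UnitaryCurve.AuxV`.  THEOREMS ONLY (no `def`, no named fact,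
no instance, no notation, no `sorry`).
Cell `hodgecm-mathlib` (D-0151), FLOOR 0, P6 «MOD programme», door (E) of `stub_RGD`, organ **E2 FILE D** (LEAD F0P6-plan (g2) 2026-09-01T21:40:57Z; GEN heir
A-p18 (g31) 21:43:24Z field types **(F2) `Mρ_kottwitz`** — «`J_Φ(v)` is `M ⊗ ℝ`-linear + the eigenvalue count of `b` on `Lie = (ℂ^g, Φ_Z)`» — and **(F3) `Mρ_rosati`**
— «frame adjointness of `b̄` against `b` for the type form»; census `F0/P6/A-p17/g27/CENSUS-E2-UnitaryCurveAuxiliaryPeriodMap.v1.A-p17g27.md` §0.7–0.8).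
`--supports stmt-HodgeConjecture-24832`, count-neutral; HC_CM is proved only modulo the printed citations until rung 0 closes.

For `b ∈ M` let `N_b := auxRepV ℝ β (t, 1) ∈ GL_{2g}(ℝ)`, `t = 1 ⊗ b ∈ (ℝ ⊗_ℚ M)ˣ` (`exists_unit_coe_eq_one_tmul`), be multiplication by `b` on `V_M ⊗ ℝ` read in the symplectic frame (★ E1 `auxRepV`, `blockGLV (t, 1) = t • 1`).
* §1 (F2-lin) `N_t` COMMUTES with `J_Φ(v)` for every `t ∈ (ℝ ⊗_ℚ M)ˣ` (both are images of commuting elements of `(ℝ ⊗ M)ˣ × GL_n` under the hom ★ `auxRepV`).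
* §2 (F3) ROSATI∕ADJOINTNESS: `ψ_V(b x, y) = ψ_V(x, b̄ y)` (★ `auxFormV`), hence in the frame **`N_bᵀ · E_δ = E_δ · N_{b̄}`** (`transpose_auxRepV_scalar_mul_typeFormOver`) —
  GEN's `Mρ_rosati` orientation `(Mρ b̄)ᵀ E = E (Mρ b)` is this at `b ↦ b̄`.
* §3 (F2-census) on the chart `k` (`q(v) ≠ 0`): **`R_k(v) · (γ N_b γ⁻¹)_ℂ = D_b · R_k(v)`** with `D_b = diag(censusEmbV(x)(b))_x` — the left `+i`-eigenrows of `γ J_Φ(v) γ⁻¹` are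
  eigenrows of the `M`-action with eigenvalues `ρ(b)` (`ρ ∈ Φ∖{ρ₀}`, multiplicity `n`), `ρ₀(b)` (`n − 1`), `ρ̄₀(b)` (`1`) (★ FILE B `censusRowV_vecMul_resMatrix_scalar`).
* §4 (F2) **`exists_lieAction_charpoly`**: for `γ J_Φ(v) γ⁻¹ ∈ C0 δ`, `Z = periodZV γ v`, there is a `ℂ`-linear `Cb` on `ℂ^g` with `Cb ∘ Φ_Z = Φ_Z ∘ (γ N_b γ⁻¹)` (★ `siegelPeriodMap`)
  and `Cb.charpoly = ∏_x (X − censusEmbV(x)(b))` — Kottwitz's `char(b | Lie A_Z)` for the marked abelian variety `A_Z = ℂ^g ∕ Φ_Z(ℤ^{2g})`.  Under the ★ sign convention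
  (`J = +i` on every `Φ`-line off the negative line) the count is `n` on `Φ∖{ρ₀}`, `n−1` at `ρ₀`, `1` at `ρ̄₀`, `0` on `Φᶜ∖{ρ̄₀}`; GEN's `mOf ι₁ Φ_GEN` is this count for the CM type
  `Φ := {ι₁} ∪ conj(Φ_GEN ∖ {ι₁})`.

## References
* [Kottwitz1992] R. E. Kottwitz, *Points on some Shimura varieties over finite fields*, JAMS 5 (1992), §5 p. 390 (the determinant condition).
* [RapoportSmithlingZhang2020Diagonal] M. Rapoport, B. Smithling, W. Zhang, Compos. Math. 156 (2020), §3.2 (3.8) p. 11, Remark 3.6 (3.14) p. 13, §4.1 p. 17.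
* [Deligne1979ShimuraVarieties] P. Deligne, *Variétés de Shimura* (1979), Prop. 2.3.10 (PDF p. 32 of Milne's translation).
* [Milne2005ShimuraVarieties] J. S. Milne, *Introduction to Shimura varieties* (2005), §6 Prop. 6.4–6.5 pp. 71–72, §8 p. 81 («the Rosati involution is `b ↦ b*`»).
* [Lange2023AbelianVarietiesComplex] H. Lange, *Abelian Varieties over the Complex Numbers* (2023), §3.1.1 («Π = (Z, D)»), §7.1.2.
-/

set_option autoImplicit false

noncomputable section

open Matrix NumberField Complex Polynomial
open scoped TensorProduct ComplexConjugate Classical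

namespace Literature.AlgebraicGeometry.ShimuraVarieties

namespace UnitaryCurve

namespace AuxV

open Literature.AlgebraicGeometry.ModuliOfAbelianVarieties
open Literature.AlgebraicGeometry.ModuliOfAbelianVarieties.SiegelModuli
open Literature.AlgebraicGeometry.Motives (CMType)
open Literature.NumberTheory.Automorphic (siegelUpperHalfSpace)
open Literature.AlgebraicGeometry.ShimuraVarieties.UnitaryCanonicalModel.Aux (conjAlgHom conjAlgHom_apply conjR conjR_tmul ratBasis iPhi iPhiVal
  coe_iPhi embOf embOf_tmul)

variable {L : Type} [Field L] (M : Type) [Field M] [NumberField M] [IsCMField M] {j : L →+* M}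
  {n : ℕ} {H : Matrix (Fin n) (Fin n) L} {ξ : M} {g : ℕ} {δ : Fin g → ℕ}
  (F : SymplecticFrameV M j H ξ g δ) (Φ : CMType M) (τ : L →+* ℂ) (k : Fin n)

/-! ### §1. (F2-lin) The scalar action commutes with `J_Φ(v)` -/

/-- **`N_t · J_Φ(v) = J_Φ(v) · N_t`** for every `t ∈ (ℝ ⊗_ℚ M)ˣ`, `N_t = auxRepV ℝ β (t, 1)`: the `M ⊗ ℝ`-action is `J_Φ(v)`-linear (the pairs `(t, 1)` and
`(iPhi, s_v)` commute in `(ℝ ⊗ M)ˣ × GL_n(ℝ ⊗ M)`). [cite: Deligne1979ShimuraVarieties, Prop. 2.3.10 (PDF p. 32)] [cite: Milne2005ShimuraVarieties, §8 p. 81] -/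
theorem auxRepV_scalar_mul_auxComplexStructureVGL (t : (ℝ ⊗[ℚ] M)ˣ) (v : Fin n → ℂ) :
    auxRepV ℝ F (t, 1) * auxComplexStructureVGL F τ Φ v = auxComplexStructureVGL F τ Φ v * auxRepV ℝ F (t, 1) := by
  rw [auxComplexStructureVGL, ← map_mul, ← map_mul, Prod.mk_mul_mk, Prod.mk_mul_mk, one_mul, mul_one, mul_comm t]

/-- The same on matrices: `N_t · J_Φ(v) = J_Φ(v) · N_t`. [cite: Deligne1979ShimuraVarieties, Prop. 2.3.10 (PDF p. 32)] -/
theorem coe_auxRepV_scalar_mul_auxComplexStructureV (t : (ℝ ⊗[ℚ] M)ˣ) (v : Fin n → ℂ) :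
    ((auxRepV ℝ F (t, 1) : GL (Fin g ⊕ Fin g) ℝ) : Matrix (Fin g ⊕ Fin g) (Fin g ⊕ Fin g) ℝ) * auxComplexStructureV F τ Φ v =
      auxComplexStructureV F τ Φ v * ((auxRepV ℝ F (t, 1) : GL (Fin g ⊕ Fin g) ℝ) : Matrix (Fin g ⊕ Fin g) (Fin g ⊕ Fin g) ℝ) := by
  rw [auxComplexStructureV, ← Units.val_mul, ← Units.val_mul, auxRepV_scalar_mul_auxComplexStructureVGL]

/-! ### §2. (F3) Rosati: `ψ_V(b x, y) = ψ_V(x, b̄ y)` and the frame adjointness `N_bᵀ E_δ = E_δ N_{b̄}` -/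

section Rosati

/-- **`ψ_V(b • x, y) = ψ_V(x, b̄ • y)`**: multiplication by `b ∈ M` on `V_M` is `ψ_V`-adjoint to multiplication by `b̄` (the trace form is `c`-sesquilinear in the
first variable). [cite: Milne2005ShimuraVarieties, §8 p. 81] -/
theorem auxFormV_smul_left (b : M) (x y : Fin n → M) :
    auxFormV M j H ξ (b • x) y = auxFormV M j H ξ x ((IsCMField.complexConj M b) • y) := by
  rw [auxFormV_apply, auxFormV_apply]
  congr 1
  rw [Matrix.mulVec_smul, dotProduct_smul, smul_eq_mul]
  have : (fun i => IsCMField.complexConj M ((b • x) i)) = IsCMField.complexConj M b • fun i => IsCMField.complexConj M (x i) := by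
    funext i
    rw [Pi.smul_apply, Pi.smul_apply, smul_eq_mul, smul_eq_mul, map_mul]
  rw [this, smul_dotProduct, smul_eq_mul]

/-- The rational matrix of multiplication by `b` on `V_M` in the symplectic frame: `u ↦ β (b • β⁻¹ u)` is `frameP · res(b•1) · frameQ`.
[cite: Milne2005ShimuraVarieties, §6 p. 67] -/
theorem framePV_mul_resMatrix_mul_frameQV_mulVec (b : M) (u : Fin g ⊕ Fin g → ℚ) :
    (framePV F * resMatrix (m := Fin n) (ratBasis M) (b • (1 : Matrix (Fin n) (Fin n) M)) * frameQV F) *ᵥ u = F.β (b • F.β.symm u) := by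
  have hu : u = ⇑((Pi.basisFun ℚ (Fin g ⊕ Fin g)).repr u) := by
    funext i
    rw [Pi.basisFun_repr]
  rw [framePV, frameQV, ← toMatrix_resBasis_mulVecLin, ← LinearMap.toMatrix_comp, ← LinearMap.toMatrix_comp]
  conv_lhs => rw [hu]
  rw [LinearMap.toMatrix_mulVec_repr]
  funext i
  rw [Pi.basisFun_repr, LinearMap.comp_apply, LinearMap.comp_apply, LinearEquiv.coe_coe, LinearEquiv.coe_coe, LinearMap.coe_restrictScalars,
    Matrix.mulVecLin_apply, Matrix.smul_mulVec, Matrix.one_mulVec]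

/-- **Frame adjointness over `ℚ`**: `(P res(b•1) Q)ᵀ · E_δ = E_δ · (P res(b̄•1) Q)`. [cite: Milne2005ShimuraVarieties, §6 p. 67, §8 p. 81] -/
theorem transpose_frame_scalar_mul_typeFormOver (b : M) :
    (framePV F * resMatrix (m := Fin n) (ratBasis M) (b • (1 : Matrix (Fin n) (Fin n) M)) * frameQV F)ᵀ * typeFormOver δ ℚ =
      typeFormOver δ ℚ * (framePV F * resMatrix (m := Fin n) (ratBasis M) ((IsCMField.complexConj M b) • (1 : Matrix (Fin n) (Fin n) M)) * frameQV F) := by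
  -- test against all pairs of coordinate vectors
  refine Matrix.ext fun a c => ?_
  have key : ∀ u u' : Fin g ⊕ Fin g → ℚ,
      ((framePV F * resMatrix (m := Fin n) (ratBasis M) (b • (1 : Matrix (Fin n) (Fin n) M)) * frameQV F) *ᵥ u) ⬝ᵥ (typeFormOver δ ℚ *ᵥ u') =
        u ⬝ᵥ (typeFormOver δ ℚ *ᵥ ((framePV F * resMatrix (m := Fin n) (ratBasis M)
          ((IsCMField.complexConj M b) • (1 : Matrix (Fin n) (Fin n) M)) * frameQV F) *ᵥ u')) := by
    intro u u'
    rw [framePV_mul_resMatrix_mul_frameQV_mulVec, framePV_mul_resMatrix_mul_frameQV_mulVec]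
    have h1 := F.gram (b • F.β.symm u) (F.β.symm u')
    have h2 := F.gram (F.β.symm u) ((IsCMField.complexConj M b) • F.β.symm u')
    rw [LinearEquiv.apply_symm_apply] at h1 h2
    rw [← h1, ← h2, auxFormV_smul_left]
  have h := key (Pi.single a 1) (Pi.single c 1)
  rw [Matrix.mulVec_single_one, Matrix.mulVec_single_one, Matrix.mulVec_mulVec, Matrix.mulVec_single_one, single_one_dotProduct] at h
  exact h

omit [IsCMField M] in
/-- `res` commutes with the base change `M → ℝ ⊗_ℚ M` read in the bases `b` and `1 ⊗ b` (= ★ `resMatrix_map_includeRight`, re-derived to keep that module's cone out).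
[cite: Deligne1979ShimuraVarieties, Prop. 2.3.10 (PDF p. 32)] -/
theorem resMatrix_map_algebraMap_eq (A : Matrix (Fin n) (Fin n) M) :
    (resMatrix (m := Fin n) (ratBasis M) A).map (algebraMap ℚ ℝ) =
      resMatrix (Algebra.TensorProduct.basis ℝ (ratBasis M)) (A.map (Algebra.TensorProduct.includeRight : M →ₐ[ℚ] ℝ ⊗[ℚ] M)) := by
  ext ⟨i, l⟩ ⟨i', l'⟩
  rw [Matrix.map_apply, resMatrix_apply, resMatrix_apply, Matrix.map_apply, Algebra.TensorProduct.basis_apply,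
    Algebra.TensorProduct.includeRight_apply, Algebra.TensorProduct.tmul_mul_tmul, one_mul,
    Algebra.TensorProduct.basis_repr_tmul, one_smul, Finsupp.mapRange_apply]

omit [IsCMField M] in
/-- A non-zero `b ∈ M` gives the unit `1 ⊗ b` of `ℝ ⊗_ℚ M`. [cite: Milne2005ShimuraVarieties, §8 p. 81] -/
theorem exists_unit_coe_eq_one_tmul (b : M) (hb : b ≠ 0) : ∃ t : (ℝ ⊗[ℚ] M)ˣ, (t : ℝ ⊗[ℚ] M) = (1 : ℝ) ⊗ₜ[ℚ] b :=
  ⟨Units.map ((Algebra.TensorProduct.includeRight : M →ₐ[ℚ] ℝ ⊗[ℚ] M) : M →* ℝ ⊗[ℚ] M) (Units.mk0 b hb), rfl⟩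

/-- The real matrix of `N_b = auxRepV ℝ β (t, 1)`, `t = 1 ⊗ b`, is the base change of the rational frame matrix of `b`. [cite: Milne2005ShimuraVarieties, §6 p. 67] -/
theorem coe_auxRepV_scalar (t : (ℝ ⊗[ℚ] M)ˣ) (b : M) (ht : (t : ℝ ⊗[ℚ] M) = (1 : ℝ) ⊗ₜ[ℚ] b) :
    ((auxRepV ℝ F (t, 1) : GL (Fin g ⊕ Fin g) ℝ) : Matrix (Fin g ⊕ Fin g) (Fin g ⊕ Fin g) ℝ) =
      (framePV F * resMatrix (m := Fin n) (ratBasis M) (b • (1 : Matrix (Fin n) (Fin n) M)) * frameQV F).map (algebraMap ℚ ℝ) := by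
  rw [auxRepV, MonoidHom.comp_apply, MonoidHom.comp_apply, coe_conjRect, coe_resGL, coe_blockGLV, Units.val_one, Matrix.map_mul, Matrix.map_mul,
    framePVR, frameQVR, resMatrix_map_algebraMap_eq, ht, smul_map, Matrix.map_one _ (map_zero _) (map_one _), Algebra.TensorProduct.includeRight_apply]

/-- **(F3) FRAME ADJOINTNESS over `ℝ`: `N_bᵀ · E_δ = E_δ · N_{b̄}`** for `N_b = auxRepV ℝ β (t, 1)`, `t = 1 ⊗ b`, `N_{b̄} = auxRepV ℝ β (t', 1)`, `t' = 1 ⊗ b̄`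
(`b̄ = complexConj b`).  GEN's `Mρ_rosati` «`(Mρ b̄)ᵀ E = E (Mρ b)`» is this identity at `b ↦ b̄`.
[cite: Milne2005ShimuraVarieties, §8 p. 81 («Rosati involution `b ↦ b*`»)] [cite: RapoportSmithlingZhang2020Diagonal, §4.1 p. 17] -/
theorem transpose_auxRepV_scalar_mul_typeFormOver (t t' : (ℝ ⊗[ℚ] M)ˣ) (b : M) (ht : (t : ℝ ⊗[ℚ] M) = (1 : ℝ) ⊗ₜ[ℚ] b)
    (ht' : (t' : ℝ ⊗[ℚ] M) = (1 : ℝ) ⊗ₜ[ℚ] (IsCMField.complexConj M b)) :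
    ((auxRepV ℝ F (t, 1) : GL (Fin g ⊕ Fin g) ℝ) : Matrix (Fin g ⊕ Fin g) (Fin g ⊕ Fin g) ℝ)ᵀ * typeFormOver δ ℝ =
      typeFormOver δ ℝ * ((auxRepV ℝ F (t', 1) : GL (Fin g ⊕ Fin g) ℝ) : Matrix (Fin g ⊕ Fin g) (Fin g ⊕ Fin g) ℝ) := by
  have h := congrArg (fun A : Matrix (Fin g ⊕ Fin g) (Fin g ⊕ Fin g) ℚ => A.map (algebraMap ℚ ℝ)) (transpose_frame_scalar_mul_typeFormOver M F b)
  simp only [Matrix.map_mul, Matrix.transpose_map, typeFormOver_map] at h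
  rw [coe_auxRepV_scalar M F t b ht, coe_auxRepV_scalar M F t' _ ht', Matrix.map_mul, Matrix.map_mul, Matrix.map_mul, Matrix.map_mul]
  exact h

end Rosati

/-! ### §3. (F2-census) The `M`-action on the left `+i`-eigenrows of `γ J_Φ(v) γ⁻¹` -/

/-- **`R_k(v) · (γ N_b γ⁻¹)_ℂ = D_b · R_k(v)`**, `D_b = diag_x(censusEmbV(x)(b))` (★ FILE B `censusRowV_vecMul_resMatrix_scalar`, ★ FILE C `coe_auxRepV_map_ofReal`).
[cite: Kottwitz1992, §5 p. 390] [cite: Deligne1979ShimuraVarieties, Prop. 2.3.10 (PDF p. 32)] -/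
theorem periodRowsV_mul_conjJ_scalar (γ : GL (Fin g ⊕ Fin g) ℝ) (v : Fin n → ℂ) (t : (ℝ ⊗[ℚ] M)ˣ) (b : M)
    (ht : (t : ℝ ⊗[ℚ] M) = (1 : ℝ) ⊗ₜ[ℚ] b) :
    periodRowsV M F Φ τ k γ v *
        (conjJ γ ((auxRepV ℝ F (t, 1) : GL (Fin g ⊕ Fin g) ℝ) : Matrix (Fin g ⊕ Fin g) (Fin g ⊕ Fin g) ℝ)).map ((↑) : ℝ → ℂ) =
      Matrix.diagonal (fun r => censusEmbV M Φ j τ k ((rowEquivV M F Φ).symm r).1 ((rowEquivV M F Φ).symm r).2 b) * periodRowsV M F Φ τ k γ v := by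
  -- the census rows are eigenrows of `res((1 ⊗ b)•1)_ℂ`
  have hB : ((blockGLV (ℝ ⊗[ℚ] M) (t, 1) : GL (Fin n) (ℝ ⊗[ℚ] M)) : Matrix (Fin n) (Fin n) (ℝ ⊗[ℚ] M)) =
      ((Algebra.TensorProduct.includeRight : M →ₐ[ℚ] ℝ ⊗[ℚ] M) b) • (1 : Matrix (Fin n) (Fin n) (ℝ ⊗[ℚ] M)) := by
    rw [coe_blockGLV, Units.val_one, ht, Algebra.TensorProduct.includeRight_apply]
  have hS : censusMatrixV M F Φ τ k v *
      (resMatrix (Algebra.TensorProduct.basis ℝ (ratBasis M))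
        ((blockGLV (ℝ ⊗[ℚ] M) (t, 1) : GL (Fin n) (ℝ ⊗[ℚ] M)) : Matrix (Fin n) (Fin n) (ℝ ⊗[ℚ] M))).map (algebraMap ℝ ℂ) =
      Matrix.diagonal (fun r => censusEmbV M Φ j τ k ((rowEquivV M F Φ).symm r).1 ((rowEquivV M F Φ).symm r).2 b) * censusMatrixV M F Φ τ k v := by
    rw [hB]
    ext r p
    rw [Matrix.diagonal_mul]
    have h := congrFun (censusRowV_vecMul_resMatrix_scalar M Φ j τ H k v ((rowEquivV M F Φ).symm r) b) p
    simp only [Matrix.vecMul, dotProduct, Pi.smul_apply, smul_eq_mul] at h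
    simp only [censusMatrixV, Matrix.mul_apply, Matrix.of_apply]
    exact h
  rw [conjJ_def, ← Complex.coe_algebraMap, Matrix.map_mul, Matrix.map_mul, Complex.coe_algebraMap, coe_auxRepV_map_ofReal M F, periodRowsV]
  calc censusMatrixV M F Φ τ k v * frameQVC M F * ((γ⁻¹ : GL (Fin g ⊕ Fin g) ℝ) : Matrix (Fin g ⊕ Fin g) (Fin g ⊕ Fin g) ℝ).map ((↑) : ℝ → ℂ) *
        ((γ : Matrix (Fin g ⊕ Fin g) (Fin g ⊕ Fin g) ℝ).map ((↑) : ℝ → ℂ) * (framePVC M F * (resMatrix (Algebra.TensorProduct.basis ℝ (ratBasis M))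
          ((blockGLV (ℝ ⊗[ℚ] M) (t, 1) : GL (Fin n) (ℝ ⊗[ℚ] M)) : Matrix (Fin n) (Fin n) (ℝ ⊗[ℚ] M))).map (algebraMap ℝ ℂ) * frameQVC M F) *
          ((γ⁻¹ : GL (Fin g ⊕ Fin g) ℝ) : Matrix (Fin g ⊕ Fin g) (Fin g ⊕ Fin g) ℝ).map ((↑) : ℝ → ℂ))
      = censusMatrixV M F Φ τ k v * (frameQVC M F * ((((γ⁻¹ : GL (Fin g ⊕ Fin g) ℝ) : Matrix (Fin g ⊕ Fin g) (Fin g ⊕ Fin g) ℝ).map ((↑) : ℝ → ℂ) *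
          (γ : Matrix (Fin g ⊕ Fin g) (Fin g ⊕ Fin g) ℝ).map ((↑) : ℝ → ℂ)) * framePVC M F)) *
          (resMatrix (Algebra.TensorProduct.basis ℝ (ratBasis M))
            ((blockGLV (ℝ ⊗[ℚ] M) (t, 1) : GL (Fin n) (ℝ ⊗[ℚ] M)) : Matrix (Fin n) (Fin n) (ℝ ⊗[ℚ] M))).map (algebraMap ℝ ℂ) *
          frameQVC M F * ((γ⁻¹ : GL (Fin g ⊕ Fin g) ℝ) : Matrix (Fin g ⊕ Fin g) (Fin g ⊕ Fin g) ℝ).map ((↑) : ℝ → ℂ) := by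
        simp only [Matrix.mul_assoc]
    _ = Matrix.diagonal (fun r => censusEmbV M Φ j τ k ((rowEquivV M F Φ).symm r).1 ((rowEquivV M F Φ).symm r).2 b) *
          (censusMatrixV M F Φ τ k v * frameQVC M F * ((γ⁻¹ : GL (Fin g ⊕ Fin g) ℝ) : Matrix (Fin g ⊕ Fin g) (Fin g ⊕ Fin g) ℝ).map ((↑) : ℝ → ℂ)) := by
        rw [map_inv_mul_map, Matrix.one_mul, frameQVC_mul_framePVC, Matrix.mul_one, hS, Matrix.mul_assoc, Matrix.mul_assoc, Matrix.mul_assoc]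

/-! ### §4. (F2) The Lie type: `Cb ∘ Φ_Z = Φ_Z ∘ (γ N_b γ⁻¹)` with `char(Cb) = ∏_x (X − censusEmbV(x)(b))` -/

omit [IsCMField M] in
/-- **The eigenvalue multiset of the census is chart-free**: `∏_{(ρ,i)} (X − censusEmbV_k(ρ,i)(b)) = ∏_{ρ∈Φ} [ρ∘j = τ ? (X − ρ̄ b)(X − ρ b)^{n−1} : (X − ρ b)^n]`.
[cite: RapoportSmithlingZhang2020Diagonal, §3.2 (3.8) p. 11] [cite: Kottwitz1992, §5 p. 390] -/
theorem prod_X_sub_C_censusEmbV (b : M) :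
    ∏ x : Φ.1 × Fin n, (Polynomial.X - Polynomial.C (censusEmbV M Φ j τ k x.1 x.2 b)) =
      ∏ ρ : Φ.1, if ρ.1.comp j = τ then
        (Polynomial.X - Polynomial.C (ComplexEmbedding.conjugate ρ.1 b)) * (Polynomial.X - Polynomial.C (ρ.1 b)) ^ (n - 1)
        else (Polynomial.X - Polynomial.C (ρ.1 b)) ^ n := by
  rw [Fintype.prod_prod_type]
  refine Finset.prod_congr rfl fun ρ _ => ?_
  by_cases hρ : ρ.1.comp j = τ
  · rw [if_pos hρ, ← Finset.mul_prod_erase Finset.univ _ (Finset.mem_univ k)]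
    congr 1
    · simp [censusEmbV, hρ]
    · rw [Finset.prod_congr rfl (fun i hi => by rw [show censusEmbV M Φ j τ k ρ i = ρ.1 by simp [censusEmbV, Finset.ne_of_mem_erase hi]]),
        Finset.prod_const, Finset.card_erase_of_mem (Finset.mem_univ _), Finset.card_univ, Fintype.card_fin]
  · rw [if_neg hρ]
    simp [censusEmbV, hρ, Finset.prod_const, Finset.card_univ]

/-- `Δ` is invertible over `ℂ` for a polarisation type with positive entries. [cite: Lange2023AbelianVarietiesComplex, §3.1.1] -/
theorem isUnit_det_diagonal_delta (hδ : ∀ i, 0 < δ i) : IsUnit (Matrix.diagonal fun i => (δ i : ℂ)).det := by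
  rw [Matrix.det_diagonal]
  exact IsUnit.mk0 _ (Finset.prod_ne_zero_iff.2 fun i _ => Nat.cast_ne_zero.2 (hδ i).ne')

/-- On the chart: the Siegel period matrix of `Z(v)` is `(Z | Δ) = Δ·R₂⁻¹·R` (★ `siegelPeriodMatrix`). [cite: Lange2023AbelianVarietiesComplex, §3.1.1 and §7.1.2 (7.3)] -/
theorem siegelPeriodMatrix_periodZV_eq (hδ : ∀ i, 0 < δ i) (γ : GL (Fin g ⊕ Fin g) ℝ) {v : Fin n → ℂ} (hk : v k ≠ 0)
    (hv : formH (H.map τ) v ≠ 0) (hC0 : conjJ γ (auxComplexStructureV F τ Φ v) ∈ C0 δ) :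
    siegelPeriodMatrix δ (periodZV M F Φ τ γ v) =
      (Matrix.diagonal fun i => (δ i : ℂ)) * (periodRowsV M F Φ τ k γ v).toCols₂⁻¹ * periodRowsV M F Φ τ k γ v := by
  have h2 : IsUnit ((periodRowsV M F Φ τ k γ v).toCols₂).det :=
    (IsUnit.mk0 _ (det_periodRowsV_toCols₂_ne_zero M F Φ τ k hδ γ hk hv hC0))
  rw [periodZV_eq_chart M F Φ τ k hδ γ hk hv hC0, periodChartMatrixV, siegelPeriodMatrix,
    show (Matrix.diagonal fun i => (δ i : ℂ)) * (periodRowsV M F Φ τ k γ v).toCols₂⁻¹ * periodRowsV M F Φ τ k γ v =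
      (Matrix.diagonal fun i => (δ i : ℂ)) * (periodRowsV M F Φ τ k γ v).toCols₂⁻¹ *
        Matrix.fromCols (periodRowsV M F Φ τ k γ v).toCols₁ (periodRowsV M F Φ τ k γ v).toCols₂ by rw [Matrix.fromCols_toCols],
    Matrix.mul_fromCols, Matrix.mul_assoc _ _ (periodRowsV M F Φ τ k γ v).toCols₂, Matrix.nonsing_inv_mul _ h2, Matrix.mul_one]

/-- **(F2) THE LIE TYPE OF THE `M`-ACTION at the period point `Z = Z(v)`** (`γ J_Φ(v) γ⁻¹ ∈ C0 δ`, `b ∈ M`, `b ≠ 0`): there is a `ℂ`-linear endomorphism `Cb` of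
`Lie = (ℂ^g, Φ_Z)` with `Cb (Φ_Z u) = Φ_Z ((γ N_b γ⁻¹) u)` for all `u ∈ ℝ^{2g}` (★ `siegelPeriodMap`), and `char(Cb) = ∏_{ρ∈Φ, ρ∘j≠τ} (X − ρ b)^n · (X − ρ̄₀ b)(X − ρ₀ b)^{n−1}` (chart-free closed
form of `∏_x (X − censusEmbV(x)(b))`): eigenvalue `ρ(b)` with multiplicity `n` for `ρ ∈ Φ∖{ρ₀}`, `ρ₀(b)` with `n−1`, `ρ̄₀(b)` with `1` — Kottwitz's determinant datum of the
marked abelian variety `ℂ^g ∕ Φ_Z(ℤ^{2g})` with its `𝒪_M`-action ([RapoportSmithlingZhang2020Diagonal] (3.8): `r_φ`; GEN's `Mρ_kottwitz`).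
[cite: Kottwitz1992, §5 p. 390] [cite: RapoportSmithlingZhang2020Diagonal, §3.2 (3.8) p. 11 and §4.1 p. 17] [cite: Lange2023AbelianVarietiesComplex, §3.1.1] -/
theorem exists_lieAction_charpoly (hδ : ∀ i, 0 < δ i) (γ : GL (Fin g ⊕ Fin g) ℝ) {v : Fin n → ℂ} (hvneg : v ∈ negCone (H.map τ))
    (hC0 : conjJ γ (auxComplexStructureV F τ Φ v) ∈ C0 δ) (t : (ℝ ⊗[ℚ] M)ˣ) (b : M) (ht : (t : ℝ ⊗[ℚ] M) = (1 : ℝ) ⊗ₜ[ℚ] b) :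
    ∃ Cb : (Fin g → ℂ) →ₗ[ℂ] (Fin g → ℂ),
      (∀ u : Fin g ⊕ Fin g → ℝ,
          Cb (siegelPeriodMap δ (periodZV M F Φ τ γ v) u) =
            siegelPeriodMap δ (periodZV M F Φ τ γ v)
              (conjJ γ ((auxRepV ℝ F (t, 1) : GL (Fin g ⊕ Fin g) ℝ) : Matrix (Fin g ⊕ Fin g) (Fin g ⊕ Fin g) ℝ) *ᵥ u)) ∧
        Cb.charpoly = ∏ ρ : Φ.1, if ρ.1.comp j = τ then
          (Polynomial.X - Polynomial.C (ComplexEmbedding.conjugate ρ.1 b)) * (Polynomial.X - Polynomial.C (ρ.1 b)) ^ (n - 1)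
          else (Polynomial.X - Polynomial.C (ρ.1 b)) ^ n := by
  -- a chart through `v`
  obtain ⟨k', hk'⟩ := Function.ne_iff.1 (ne_zero_of_mem_negCone (H.map τ) hvneg)
  have hv : formH (H.map τ) v ≠ 0 := formH_ne_zero_of_mem_negCone (H.map τ) hvneg
  set R := periodRowsV M F Φ τ k' γ v with hR
  set Δ : Matrix (Fin g) (Fin g) ℂ := Matrix.diagonal fun i => (δ i : ℂ) with hΔ
  set D : Matrix (Fin g) (Fin g) ℂ := Matrix.diagonal (fun r => censusEmbV M Φ j τ k' ((rowEquivV M F Φ).symm r).1 ((rowEquivV M F Φ).symm r).2 b) with hD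
  have hΔu : IsUnit Δ.det := isUnit_det_diagonal_delta hδ
  have hR2u : IsUnit (R.toCols₂).det := IsUnit.mk0 _ (det_periodRowsV_toCols₂_ne_zero M F Φ τ k' hδ γ hk' hv hC0)
  -- `U := Δ R₂⁻¹` is a unit
  have hUu : IsUnit (Δ * R.toCols₂⁻¹).det := by
    rw [Matrix.det_mul]
    exact hΔu.mul (Matrix.isUnit_nonsing_inv_det_iff.2 hR2u)
  obtain ⟨U, hU⟩ := (Matrix.isUnit_iff_isUnit_det _).2 hUu
  refine ⟨Matrix.toLin' (U.val * D * U.val⁻¹), fun u => ?_, ?_⟩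
  · -- `Cb (Π u) = Π (N u)`
    have hPer : siegelPeriodMatrix δ (periodZV M F Φ τ γ v) = Δ * R.toCols₂⁻¹ * R := siegelPeriodMatrix_periodZV_eq M F Φ τ k' hδ γ hk' hv hC0
    have hDR := periodRowsV_mul_conjJ_scalar M F Φ τ k' γ v t b ht
    have hcast : (fun c => (((conjJ γ ((auxRepV ℝ F (t, 1) : GL (Fin g ⊕ Fin g) ℝ) : Matrix (Fin g ⊕ Fin g) (Fin g ⊕ Fin g) ℝ)) *ᵥ u) c : ℂ)) =
        (conjJ γ ((auxRepV ℝ F (t, 1) : GL (Fin g ⊕ Fin g) ℝ) : Matrix (Fin g ⊕ Fin g) (Fin g ⊕ Fin g) ℝ)).map ((↑) : ℝ → ℂ) *ᵥ fun c => (u c : ℂ) := by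
      funext c
      rw [← Complex.coe_algebraMap, RingHom.map_mulVec]
      rfl
    rw [← hR, ← hD] at hDR
    rw [siegelPeriodMap_eq_mulVec, siegelPeriodMap_eq_mulVec, Matrix.toLin'_apply, hPer, hU, Matrix.mulVec_mulVec, hcast, Matrix.mulVec_mulVec]
    congr 1
    have hUinv : (Δ * R.toCols₂⁻¹)⁻¹ * (Δ * R.toCols₂⁻¹) = 1 := Matrix.nonsing_inv_mul _ hUu
    calc Δ * R.toCols₂⁻¹ * D * (Δ * R.toCols₂⁻¹)⁻¹ * (Δ * R.toCols₂⁻¹ * R)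
        = Δ * R.toCols₂⁻¹ * D * ((Δ * R.toCols₂⁻¹)⁻¹ * (Δ * R.toCols₂⁻¹)) * R := by simp only [Matrix.mul_assoc]
      _ = Δ * R.toCols₂⁻¹ * (D * R) := by rw [hUinv, Matrix.mul_one, Matrix.mul_assoc]
      _ = Δ * R.toCols₂⁻¹ * R * (conjJ γ ((auxRepV ℝ F (t, 1) : GL (Fin g ⊕ Fin g) ℝ) : Matrix (Fin g ⊕ Fin g) (Fin g ⊕ Fin g) ℝ)).map ((↑) : ℝ → ℂ) := by
          rw [← hDR]; simp only [Matrix.mul_assoc]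
  · -- characteristic polynomial
    rw [Matrix.charpoly_toLin', Matrix.charpoly_units_conj, hD, Matrix.charpoly_diagonal, ← prod_X_sub_C_censusEmbV M Φ τ k' b]
    exact Fintype.prod_equiv (rowEquivV M F Φ).symm _ _ fun r => rfl

end AuxV

end UnitaryCurve

end Literature.AlgebraicGeometry.ShimuraVarieties

end
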